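import Summits.BirchSwinnertonDyer.BirchSwinnertonDyer.Theorems.CyclotomicUntwistBallSystems
import Literature.NumberTheory.IwasawaTheory.PSCyclotomicLFunction
import HarnessLib

/-!
# The Γ-pushforward of an additive ball-value system on `ℤ_p^×` is a Γ-distribution
# (`IsGammaDistribution`): the Teichmüller-class bookkeeping of F1 for route CyclotomicUntwist

Cell `pub/bsd-wall` (D-0145 line `route-BirchSwinnertonDyer-CyclotomicUntwist`), seat `bsd-line-cycu-p1`
(prover seat 1/3, K1 base), helper toward crux K1 `PSRankOneLowerHalfAtThree`
(stmt-BirchSwinnertonDyer-21580). THEOREMS ONLY (no definition, no named fact, no `sorry`); BSD is not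
proved by this file and no crux is.

D1 (`Literature.NumberTheory.IwasawaTheory.PSCyclotomicLFunction`) encodes a distribution on
`Γ = 1 + p^{e₀}ℤ_p` by ball values `μ n s` on `γ^s Γ^{pⁿ} = γ^s + p^{n+e₀}ℤ_p` (`γ = cyclotomicGenerator p`,
`e₀ = cyclotomicExponent p`), with additivity `IsGammaDistribution p μ`. Given ANY ball-value system `ρ` on
`ℤ_p` that is additive (filtered fibres) from some level `c` on, its PUSHFORWARD along `x ↦ ⟨x⟩`
(`ℤ_p^× = μ_τ × Γ`, Teichmüller classes `η γ^s` of the tree's `PAdicLFunctionInterpolationProofs`) is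

  `𝓛 n s = ∑_η ∑_{y mod p^{c+e₀+n}, y ≡ η γ^s (mod p^{e₀+n})} ρ_{c+e₀+n}(y)`

(level `c + e₀ + n ≥ c` so that `ρ` is additive there; hypothesis `h𝓛`). THIS FILE PROVES
`isGammaDistribution_pushforward : IsGammaDistribution p 𝓛`: for each Teichmüller class, the classes
`η γ^t (mod p^{e₀+n+1})` with `t ≡ s (mod pⁿ)` partition the preimage of `η γ^s (mod p^{e₀+n})`
(`exists_cls_succ_of_castHom_eq`, `castHom_cls_succ`, injectivity from the tree's `classMap_injective`),
and `ρ`'s additivity at level `c + e₀ + n` collapses the extra level. Levels are written `e₀ + n` and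
`c + e₀ + n` (not `n + e₀`) so that level `n + 1` is DEFINITIONALLY the successor level; the tree's class
lemmas (stated with `n + e₀`) are transported along `Nat.add_comm`. Used with `ρ = η̄·ν` for the untwisted
MTT system `ν` of `CyclotomicUntwistUntwistedSymbolSystem` (next file), this is the additivity clause of
`IsUntwistedPAdicLFunction`.

References: [cite: MazurTateTeitelbaum1986Invent, §I.11 and §I.13]; Washington, *Cyclotomic fields*, §7.2
(`ℤ_p^× = μ × (1 + p^{e₀}ℤ_p)`) [folklore].
-/

noncomputable section

open Literature.NumberTheory.EllipticCurves Literature.NumberTheory.IwasawaTheory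

-- single-conjunct summit: `Summit.BirchSwinnertonDyer.BirchSwinnertonDyer.…` repeats the name by design
set_option linter.dupNamespace false
set_option autoImplicit false

namespace Summit.BirchSwinnertonDyer.BirchSwinnertonDyer.Theorems.PSPushforward

variable {p : ℕ} [Fact p.Prime]

/-! ### §1 The Teichmüller classes at level `e₀ + n` (tree lemmas transported along `n + e₀ = e₀ + n`) -/

section Classes

variable (p)

/-- `orderOf γ = pⁿ` modulo `p^{e₀+n}` (tree: `orderOf_cyclotomicGenerator`, levels `n + e₀`). [folklore] -/
theorem orderOf_gamma (n : ℕ) :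
    orderOf (cyclotomicGenerator p : ZMod (p ^ (cyclotomicExponent p + n))) = p ^ n := by
  have h := orderOf_cyclotomicGenerator p n
  rwa [Nat.add_comm n] at h

/-- `γ^a = γ^{a mod pⁿ}` modulo `p^{e₀+n}`. [folklore] -/
theorem gamma_pow_eq_pow_mod (n a : ℕ) :
    (cyclotomicGenerator p : ZMod (p ^ (cyclotomicExponent p + n))) ^ a =
      (cyclotomicGenerator p : ZMod (p ^ (cyclotomicExponent p + n))) ^ (a % p ^ n) := by
  rw [← orderOf_gamma p n, pow_mod_orderOf]

/-- `γ^a = γ^b (mod p^{e₀+n}) ↔ a ≡ b (mod pⁿ)`. [folklore] -/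
theorem gamma_pow_eq_pow_iff (n a b : ℕ) :
    (cyclotomicGenerator p : ZMod (p ^ (cyclotomicExponent p + n))) ^ a =
        (cyclotomicGenerator p : ZMod (p ^ (cyclotomicExponent p + n))) ^ b ↔ a ≡ b [MOD p ^ n] := by
  have hfin : IsOfFinOrder (cyclotomicGenerator p : ZMod (p ^ (cyclotomicExponent p + n))) :=
    orderOf_pos_iff.mp (by rw [orderOf_gamma]; exact pow_pos (Fact.out : p.Prime).pos _)
  rw [hfin.pow_eq_pow_iff_modEq, orderOf_gamma]

/-- Teichmüller representatives are units modulo every `p^k`. [folklore] -/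
theorem isUnit_toZModPow_teich (k : ℕ) (T : rootsOfUnity (torsionOrder p) ℤ_[p]) :
    IsUnit (PadicInt.toZModPow k ((T : ℤ_[p]ˣ) : ℤ_[p])) :=
  (Units.isUnit _).map _

/-- The class `η γ^s (mod p^{e₀+n})` is a unit. [folklore] -/
theorem isUnit_cls (n : ℕ) (T : rootsOfUnity (torsionOrder p) ℤ_[p]) (a : ℕ) :
    IsUnit (PadicInt.toZModPow (cyclotomicExponent p + n) ((T : ℤ_[p]ˣ) : ℤ_[p]) *
      (cyclotomicGenerator p : ZMod (p ^ (cyclotomicExponent p + n))) ^ a) :=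
  (isUnit_toZModPow_teich p _ T).mul ((isUnit_cyclotomicGenerator_cast p _).pow _)

/-- **Injectivity of the class map at level `e₀ + n`** (tree: `classMap_injective`): `η γ^a = η' γ^b`
modulo `p^{e₀+n}` forces `η = η'` and `a ≡ b (mod pⁿ)`. [folklore] -/
theorem cls_eq_cls_iff (n : ℕ) (T T' : rootsOfUnity (torsionOrder p) ℤ_[p]) (a b : ℕ) :
    PadicInt.toZModPow (cyclotomicExponent p + n) ((T : ℤ_[p]ˣ) : ℤ_[p]) *
        (cyclotomicGenerator p : ZMod (p ^ (cyclotomicExponent p + n))) ^ a =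
      PadicInt.toZModPow (cyclotomicExponent p + n) ((T' : ℤ_[p]ˣ) : ℤ_[p]) *
        (cyclotomicGenerator p : ZMod (p ^ (cyclotomicExponent p + n))) ^ b ↔
      T = T' ∧ a ≡ b [MOD p ^ n] := by
  constructor
  · intro h
    -- reduce modulo `p^{e₀}`: `γ ≡ 1`, Teichmüller representatives are distinct
    have hle : cyclotomicExponent p ≤ cyclotomicExponent p + n := Nat.le_add_right _ _
    have h' := congr_arg (ZMod.castHom (pow_dvd_pow p hle) (ZMod (p ^ cyclotomicExponent p))) h
    simp only [map_mul, map_pow, map_natCast, cyclotomicGenerator_cast_cyclotomicExponent, one_pow,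
      mul_one, ZMod.castHom_apply, PadicInt.cast_toZModPow _ _ hle] at h'
    have hT : T = T' := toZModPow_rootsOfUnity_injective p h'
    subst hT
    refine ⟨rfl, ?_⟩
    have hu := isUnit_toZModPow_teich p (cyclotomicExponent p + n) T
    exact (gamma_pow_eq_pow_iff p n a b).mp (hu.mul_right_inj.mp h)
  · rintro ⟨rfl, hab⟩
    rw [(gamma_pow_eq_pow_iff p n a b).mpr hab]

/-- **Surjectivity of the class map**: every unit modulo `p^{e₀+n}` is `η γ^a` for some Teichmüller `η` and
some `a < pⁿ` (injective map between finite sets of equal size; tree: `card_classDomain`). [folklore] -/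
theorem exists_cls_eq_of_isUnit (n : ℕ) {u : ZMod (p ^ (cyclotomicExponent p + n))} (hu : IsUnit u) :
    ∃ (T : rootsOfUnity (torsionOrder p) ℤ_[p]) (s : ZMod (p ^ n)),
      PadicInt.toZModPow (cyclotomicExponent p + n) ((T : ℤ_[p]ˣ) : ℤ_[p]) *
        (cyclotomicGenerator p : ZMod (p ^ (cyclotomicExponent p + n))) ^ s.val = u := by
  classical
  haveI := neZero_torsionOrder p
  haveI := Fintype.ofFinite (rootsOfUnity (torsionOrder p) ℤ_[p])
  haveI : NeZero (p ^ (cyclotomicExponent p + n)) := ⟨pow_ne_zero _ (Fact.out : p.Prime).ne_zero⟩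
  set Φ : rootsOfUnity (torsionOrder p) ℤ_[p] × ZMod (p ^ n) → (ZMod (p ^ (cyclotomicExponent p + n)))ˣ :=
    fun x ↦ (isUnit_cls p n x.1 x.2.val).unit with hΦ
  have hΦinj : Function.Injective Φ := by
    rintro ⟨T, s⟩ ⟨T', s'⟩ hxy
    have h := congr_arg Units.val hxy
    simp only [hΦ, IsUnit.unit_spec] at h
    obtain ⟨hT, hs⟩ := (cls_eq_cls_iff p n T T' s.val s'.val).mp h
    haveI : NeZero (p ^ n) := ⟨pow_ne_zero _ (Fact.out : p.Prime).ne_zero⟩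
    exact Prod.ext hT (ZMod.val_injective _ (Nat.ModEq.eq_of_lt_of_lt hs (ZMod.val_lt s) (ZMod.val_lt s')))
  have hcard : Fintype.card (rootsOfUnity (torsionOrder p) ℤ_[p] × ZMod (p ^ n)) =
      Fintype.card (ZMod (p ^ (cyclotomicExponent p + n)))ˣ := by
    have h := card_classDomain p n
    rwa [Nat.add_comm n] at h
  have hΦbij : Function.Bijective Φ := (Fintype.bijective_iff_injective_and_card Φ).mpr ⟨hΦinj, hcard⟩
  obtain ⟨⟨T, s⟩, hx⟩ := hΦbij.2 hu.unit
  refine ⟨T, s, ?_⟩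
  have h := congr_arg Units.val hx
  simp only [hΦ, IsUnit.unit_spec] at h
  exact h

end Classes

/-! ### §2 The classes above a class: `{η γ^t : t ≡ s (pⁿ)}` at level `e₀+n+1` over `η γ^s` at level `e₀+n` -/

section Above

variable (p)

/-- Going down one level: for `t ≡ s (mod pⁿ)`, `η γ^t (mod p^{e₀+n+1})` reduces to `η γ^s (mod p^{e₀+n})`.
[folklore] -/
theorem castHom_cls_succ (n : ℕ) (T : rootsOfUnity (torsionOrder p) ℤ_[p]) {t : ZMod (p ^ (n + 1))}
    {s : ZMod (p ^ n)} (hts : ZMod.castHom (pow_dvd_pow p n.le_succ) (ZMod (p ^ n)) t = s) :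
    ZMod.castHom (pow_dvd_pow p (cyclotomicExponent p + n).le_succ) (ZMod (p ^ (cyclotomicExponent p + n)))
        (PadicInt.toZModPow (cyclotomicExponent p + (n + 1)) ((T : ℤ_[p]ˣ) : ℤ_[p]) *
          (cyclotomicGenerator p : ZMod (p ^ (cyclotomicExponent p + (n + 1)))) ^ t.val) =
      PadicInt.toZModPow (cyclotomicExponent p + n) ((T : ℤ_[p]ˣ) : ℤ_[p]) *
        (cyclotomicGenerator p : ZMod (p ^ (cyclotomicExponent p + n))) ^ s.val := by
  haveI : NeZero (p ^ n) := ⟨pow_ne_zero _ (Fact.out : p.Prime).ne_zero⟩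
  have hle : cyclotomicExponent p + n ≤ cyclotomicExponent p + (n + 1) := by omega
  rw [map_mul, map_pow, map_natCast, ZMod.castHom_apply, PadicInt.cast_toZModPow _ _ hle,
    gamma_pow_eq_pow_mod p n t.val]
  congr 2
  rw [← hts, ZMod.castHom_apply, ZMod.cast_eq_val, ZMod.val_natCast]

/-- Going up one level: a `y` modulo `p^{e₀+n+1}` lying over `η γ^s (mod p^{e₀+n})` IS a class `η γ^t`
with `t ≡ s (mod pⁿ)` (same Teichmüller representative). [folklore] -/
theorem exists_cls_succ_of_castHom_eq (n : ℕ) (T : rootsOfUnity (torsionOrder p) ℤ_[p])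
    (s : ZMod (p ^ n)) {y : ZMod (p ^ (cyclotomicExponent p + (n + 1)))}
    (hy : ZMod.castHom (pow_dvd_pow p (cyclotomicExponent p + n).le_succ)
        (ZMod (p ^ (cyclotomicExponent p + n))) y =
      PadicInt.toZModPow (cyclotomicExponent p + n) ((T : ℤ_[p]ˣ) : ℤ_[p]) *
        (cyclotomicGenerator p : ZMod (p ^ (cyclotomicExponent p + n))) ^ s.val) :
    ∃ t : ZMod (p ^ (n + 1)), ZMod.castHom (pow_dvd_pow p n.le_succ) (ZMod (p ^ n)) t = s ∧
      y = PadicInt.toZModPow (cyclotomicExponent p + (n + 1)) ((T : ℤ_[p]ˣ) : ℤ_[p]) *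
        (cyclotomicGenerator p : ZMod (p ^ (cyclotomicExponent p + (n + 1)))) ^ t.val := by
  haveI : NeZero (p ^ n) := ⟨pow_ne_zero _ (Fact.out : p.Prime).ne_zero⟩
  haveI : NeZero (p ^ (n + 1)) := ⟨pow_ne_zero _ (Fact.out : p.Prime).ne_zero⟩
  -- `y` is a unit (its reduction is)
  have hyu : IsUnit y := by
    have h1 : 1 ≤ cyclotomicExponent p + n :=
      le_add_right (Nat.pos_of_ne_zero (cyclotomicExponent_ne_zero p))
    rw [isUnit_iff_isUnit_castHom (p := p) h1 (cyclotomicExponent p + n).le_succ, hy]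
    exact isUnit_cls p n T s.val
  obtain ⟨T', t, ht⟩ := exists_cls_eq_of_isUnit p (n + 1) hyu
  -- reduce to level `e₀ + n`: same `η`, exponents congruent mod `pⁿ`
  have hred := congr_arg (ZMod.castHom (pow_dvd_pow p (cyclotomicExponent p + n).le_succ)
    (ZMod (p ^ (cyclotomicExponent p + n)))) ht
  rw [hy, castHom_cls_succ p n T' (t := t) rfl] at hred
  obtain ⟨hT, hmod⟩ := (cls_eq_cls_iff p n T' T _ s.val).mp hred
  subst hT
  refine ⟨t, ?_, ht.symm⟩
  -- `t mod pⁿ = s`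
  rw [ZMod.castHom_apply, ZMod.cast_eq_val, ZMod.val_natCast] at hmod
  rw [ZMod.castHom_apply, ZMod.cast_eq_val, ← ZMod.natCast_zmod_val s]
  exact (ZMod.natCast_eq_natCast_iff _ _ _).mpr ((Nat.mod_modEq _ _).symm.trans hmod)

end Above

/-! ### §3 The pushforward is a Γ-distribution -/

section Pushforward

variable {c : ℕ} (ρ : (M : ℕ) → ZMod (p ^ M) → ℂ_[p])
variable (hρ : ∀ M : ℕ, c ≤ M → ∀ a : ZMod (p ^ M),
  ∑ b ∈ Finset.univ.filter (fun b : ZMod (p ^ (M + 1)) ↦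
    ZMod.castHom (pow_dvd_pow p M.le_succ) (ZMod (p ^ M)) b = a), ρ (M + 1) b = ρ M a)
variable (𝓛 : (n : ℕ) → ZMod (p ^ n) → ℂ_[p])
variable (h𝓛 : ∀ (n : ℕ) (s : ZMod (p ^ n)), 𝓛 n s =
  ∑ᶠ T : rootsOfUnity (torsionOrder p) ℤ_[p],
    ∑ y ∈ Finset.univ.filter (fun y : ZMod (p ^ (c + cyclotomicExponent p + n)) ↦
      ZMod.castHom (pow_dvd_pow p (by omega : cyclotomicExponent p + n ≤ c + cyclotomicExponent p + n))
          (ZMod (p ^ (cyclotomicExponent p + n))) y =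
        PadicInt.toZModPow (cyclotomicExponent p + n) ((T : ℤ_[p]ˣ) : ℤ_[p]) *
          (cyclotomicGenerator p : ZMod (p ^ (cyclotomicExponent p + n))) ^ s.val),
      ρ (c + cyclotomicExponent p + n) y)

include hρ in
/-- For one Teichmüller class: the sum of `ρ` at level `c+e₀+n+1` over the points above `η γ^s (mod p^{e₀+n})`
equals the sum of `ρ` at level `c+e₀+n` over the same (coarser) set — additivity of `ρ` at level
`c + e₀ + n ≥ c`. [cite: MazurTateTeitelbaum1986Invent, §I.11] -/
theorem sum_above_succ_eq (n : ℕ) (v : ZMod (p ^ (cyclotomicExponent p + n))) :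
    ∑ y ∈ Finset.univ.filter (fun y : ZMod (p ^ (c + cyclotomicExponent p + n + 1)) ↦
      ZMod.castHom (pow_dvd_pow p (by omega : cyclotomicExponent p + n ≤ c + cyclotomicExponent p + n + 1))
        (ZMod (p ^ (cyclotomicExponent p + n))) y = v), ρ (c + cyclotomicExponent p + n + 1) y =
    ∑ y' ∈ Finset.univ.filter (fun y' : ZMod (p ^ (c + cyclotomicExponent p + n)) ↦
      ZMod.castHom (pow_dvd_pow p (by omega : cyclotomicExponent p + n ≤ c + cyclotomicExponent p + n))
        (ZMod (p ^ (cyclotomicExponent p + n))) y' = v), ρ (c + cyclotomicExponent p + n) y' := by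
  classical
  set L := c + cyclotomicExponent p + n with hL
  have hEL : cyclotomicExponent p + n ≤ L := by omega
  set πL := ZMod.castHom (pow_dvd_pow p L.le_succ) (ZMod (p ^ L)) with hπL
  set πv := ZMod.castHom (pow_dvd_pow p hEL) (ZMod (p ^ (cyclotomicExponent p + n))) with hπv
  set πv' := ZMod.castHom (pow_dvd_pow p (hEL.trans L.le_succ)) (ZMod (p ^ (cyclotomicExponent p + n)))
    with hπv'
  have hcomp : ∀ y : ZMod (p ^ (L + 1)), πv (πL y) = πv' y := fun y ↦
    RingHom.congr_fun (RingHom.ext_zmod (πv.comp πL) πv') y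
  rw [← Finset.sum_fiberwise_of_maps_to
    (s := Finset.univ.filter (fun y : ZMod (p ^ (L + 1)) ↦ πv' y = v))
    (t := Finset.univ.filter (fun y' : ZMod (p ^ L) ↦ πv y' = v)) (g := πL) ?_]
  · refine Finset.sum_congr rfl fun y' hy' ↦ ?_
    rw [← hρ L (by omega) y']
    refine Finset.sum_congr ?_ fun _ _ ↦ rfl
    ext y
    simp only [Finset.mem_filter, Finset.mem_univ, true_and]
    constructor
    · rintro ⟨-, h⟩
      exact h
    · intro h
      refine ⟨?_, h⟩
      have h2 : πv (πL y) = v := by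
        have h' : πL y = y' := h
        rw [h']
        exact (Finset.mem_filter.mp hy').2
      rwa [hcomp] at h2
  · intro y hy
    simp only [Finset.mem_filter, Finset.mem_univ, true_and] at hy ⊢
    rw [hcomp]
    exact hy

/-- For one Teichmüller class `η`: the classes `η γ^t (mod p^{e₀+n+1})`, `t ≡ s (mod pⁿ)`, partition the set of
points above `η γ^s (mod p^{e₀+n})` — so summing `ρ` at level `c+e₀+n+1` over them is summing over that set.
[cite: MazurTateTeitelbaum1986Invent, §I.13] -/
theorem sum_fibre_sum_classes_eq (n : ℕ) (T : rootsOfUnity (torsionOrder p) ℤ_[p]) (s : ZMod (p ^ n)) :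
    ∑ t ∈ Finset.univ.filter
        (fun t : ZMod (p ^ (n + 1)) ↦ ZMod.castHom (pow_dvd_pow p n.le_succ) (ZMod (p ^ n)) t = s),
      ∑ y ∈ Finset.univ.filter (fun y : ZMod (p ^ (c + cyclotomicExponent p + (n + 1))) ↦
        ZMod.castHom (pow_dvd_pow p
            (by omega : cyclotomicExponent p + (n + 1) ≤ c + cyclotomicExponent p + (n + 1)))
          (ZMod (p ^ (cyclotomicExponent p + (n + 1)))) y =
          PadicInt.toZModPow (cyclotomicExponent p + (n + 1)) ((T : ℤ_[p]ˣ) : ℤ_[p]) *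
            (cyclotomicGenerator p : ZMod (p ^ (cyclotomicExponent p + (n + 1)))) ^ t.val),
        ρ (c + cyclotomicExponent p + (n + 1)) y =
    ∑ y ∈ Finset.univ.filter (fun y : ZMod (p ^ (c + cyclotomicExponent p + n + 1)) ↦
      ZMod.castHom (pow_dvd_pow p (by omega : cyclotomicExponent p + n ≤ c + cyclotomicExponent p + n + 1))
        (ZMod (p ^ (cyclotomicExponent p + n))) y =
        PadicInt.toZModPow (cyclotomicExponent p + n) ((T : ℤ_[p]ˣ) : ℤ_[p]) *
          (cyclotomicGenerator p : ZMod (p ^ (cyclotomicExponent p + n))) ^ s.val),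
      ρ (c + cyclotomicExponent p + n + 1) y := by
  classical
  haveI : NeZero (p ^ (n + 1)) := ⟨pow_ne_zero _ (Fact.out : p.Prime).ne_zero⟩
  set L := c + cyclotomicExponent p + n with hL
  -- the two reduction maps from level `L + 1`
  have hE1 : cyclotomicExponent p + (n + 1) ≤ L + 1 := by omega
  have hE0 : cyclotomicExponent p + n ≤ L + 1 := by omega
  set π1 := ZMod.castHom (pow_dvd_pow p hE1) (ZMod (p ^ (cyclotomicExponent p + (n + 1)))) with hπ1
  set π0 := ZMod.castHom (pow_dvd_pow p hE0) (ZMod (p ^ (cyclotomicExponent p + n))) with hπ0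
  set πE := ZMod.castHom (pow_dvd_pow p (cyclotomicExponent p + n).le_succ)
    (ZMod (p ^ (cyclotomicExponent p + n))) with hπE
  have hcomp : ∀ y : ZMod (p ^ (L + 1)), πE (π1 y) = π0 y := fun y ↦
    RingHom.congr_fun (RingHom.ext_zmod (πE.comp π1) π0) y
  -- notation for the classes
  set cls1 : ZMod (p ^ (n + 1)) → ZMod (p ^ (cyclotomicExponent p + (n + 1))) := fun t ↦
    PadicInt.toZModPow (cyclotomicExponent p + (n + 1)) ((T : ℤ_[p]ˣ) : ℤ_[p]) *
      (cyclotomicGenerator p : ZMod (p ^ (cyclotomicExponent p + (n + 1)))) ^ t.val with hcls1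
  set cls0 : ZMod (p ^ (cyclotomicExponent p + n)) :=
    PadicInt.toZModPow (cyclotomicExponent p + n) ((T : ℤ_[p]ˣ) : ℤ_[p]) *
      (cyclotomicGenerator p : ZMod (p ^ (cyclotomicExponent p + n))) ^ s.val with hcls0
  set S := Finset.univ.filter
    (fun t : ZMod (p ^ (n + 1)) ↦ ZMod.castHom (pow_dvd_pow p n.le_succ) (ZMod (p ^ n)) t = s) with hS
  set F : ZMod (p ^ (n + 1)) → Finset (ZMod (p ^ (L + 1))) :=
    fun t ↦ Finset.univ.filter (fun y ↦ π1 y = cls1 t) with hF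
  show ∑ t ∈ S, ∑ y ∈ F t, ρ (L + 1) y = ∑ y ∈ Finset.univ.filter (fun y ↦ π0 y = cls0), ρ (L + 1) y
  -- disjointness of the classes
  have hdisj : (S : Set (ZMod (p ^ (n + 1)))).PairwiseDisjoint F := by
    intro t₁ _ t₂ _ hne
    rw [Function.onFun, Finset.disjoint_left]
    intro y hy1 hy2
    apply hne
    have h1 := (Finset.mem_filter.mp hy1).2
    have h2 := (Finset.mem_filter.mp hy2).2
    rw [h1] at h2
    obtain ⟨-, hmod⟩ := (cls_eq_cls_iff p (n + 1) T T t₁.val t₂.val).mp h2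
    exact ZMod.val_injective _ (Nat.ModEq.eq_of_lt_of_lt hmod (ZMod.val_lt t₁) (ZMod.val_lt t₂))
  rw [← Finset.sum_biUnion hdisj]
  refine Finset.sum_congr ?_ fun _ _ ↦ rfl
  -- the union of the classes is the set of points above `cls0`
  ext y
  simp only [Finset.mem_biUnion, Finset.mem_filter, Finset.mem_univ, true_and, hS, hF]
  constructor
  · rintro ⟨t, hts, hyt⟩
    rw [← hcomp, hyt, hcls1]
    exact castHom_cls_succ p n T hts
  · intro hy
    have hy' : πE (π1 y) = cls0 := by rw [hcomp]; exact hy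
    obtain ⟨t, hts, ht⟩ := exists_cls_succ_of_castHom_eq p n T s hy'
    exact ⟨t, hts, ht⟩

include hρ h𝓛 in
/-- **The Γ-pushforward of an eventually additive ball system is a Γ-distribution.**
[cite: MazurTateTeitelbaum1986Invent, §I.11 and §I.13] -/
theorem isGammaDistribution_pushforward : IsGammaDistribution p 𝓛 := by
  classical
  haveI := neZero_torsionOrder p
  haveI := Fintype.ofFinite (rootsOfUnity (torsionOrder p) ℤ_[p])
  intro n s
  simp_rw [h𝓛, finsum_eq_sum_of_fintype]
  rw [Finset.sum_comm]
  refine Finset.sum_congr rfl fun T _ ↦ ?_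
  rw [sum_fibre_sum_classes_eq (p := p) ρ n T s]
  exact sum_above_succ_eq ρ hρ n _

end Pushforward

end Summit.BirchSwinnertonDyer.BirchSwinnertonDyer.Theorems.PSPushforward
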